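import Literature.AlgebraicGeometry.HodgeTheory.WeilClassesFieldQuaternionOverRealFieldDecomposable
import HarnessLib

/-!
# Moonen–Zarhin's Criterion (2), the `m = 1` type-2 rows FROM End-LEVEL DATA: `φ ∈ ℤ⟨Γ⟩ ⊆ End(A) ⟹ φ^* ∈ ℂ⟨γ^*⟩`
# (pull-back on `H¹` is a ring antihomomorphism); `Γ = {α, β}` and `Γ = {ψ, α, β}` discharge the hypotheses `hF` of the
# quaternion rows on `A` (Moonen–Zarhin 1998 §1)

Layer `Literature/AlgebraicGeometry/HodgeTheory`; THEOREMS ONLY — no definition, no named fact, no `sorry` (D-0026, net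
debt 0).  The `m = 1` companion of the seat's `WeilClassesFieldSubringMatricesDecomposable` (powers).

## The print

B. J. J. Moonen, Yu. G. Zarhin, *Weil classes on abelian varieties*, J. reine angew. Math. 496 (1998) 83–92 =
arXiv:alg-geom/9612017 [MoonenZarhin1998WeilClasses] (held text `paper:arxiv-alg-geom_9612017`), §1 (chunk p0002
L44–L84: `F ⊆ End⁰(X)` a subfield, Table 1 «Type 2: B = M_m(D)», here `m = 1`) and Criterion (2) with its proof
(chunk p0003 L46–L90).

## What is proved (on `H¹(A(ℂ); ℂ)`)

* **`pullbackOne_mem_adjoin_of_mem_closure`** — `g ∈ Subring.closure Γ ⟹ g^* ∈ ℂ⟨γ^* : γ ∈ Γ⟩` (stated with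
  `End.of` / `End.asHom`); `pullbackOne_mem_adjoin_pair_of_mem_closure`, `pullbackOne_mem_adjoin_triple_of_mem_closure`.
* **`weilClassesField_le_algebraicClasses_of_mem_closure_quaternionPair`** — `…_of_quaternionPair`
  (`WeilClassesFieldDecomposableOfMatrixUnits`) with `hF` replaced by `φ ∈ ℤ⟨α, β⟩`.
* **`weilClassesField_le_algebraicClasses_of_mem_closure_quaternionOver`** — `…_of_mem_adjoin_quaternionOver`
  (`WeilClassesFieldQuaternionOverRealFieldDecomposable`) with `hF` replaced by `φ ∈ ℤ⟨ψ, α, β⟩`.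

Scope (honest column).  Integral data (`φ` in the subRING generated; `ℚ(φ) = ℚ(Nφ)` for denominators, not restated);
otherwise as the rows.

## References

* [MoonenZarhin1998WeilClasses] B. J. J. Moonen, Yu. G. Zarhin, Weil classes on abelian varieties, J. reine angew.
  Math. 496 (1998) 83–92; arXiv:alg-geom/9612017: §1 (chunk p0002 L44–L84), Criterion (2) and its proof (chunk p0003
  L46–L90).
* [LangeBirkenhake1992] H. Lange, Ch. Birkenhake, Complex Abelian Varieties (1992), §1.1.
* [VoisinHodgeI2002] C. Voisin, Hodge Theory and Complex Algebraic Geometry I (CUP 2002), Thm. 11.30.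

## Provenance

Lane `lit-hodgefound` (Track 2, Layer A), prover seat `lit-hodgefound-p21` (generation 21), row g21-#10.
-/

noncomputable section

open CategoryTheory CategoryTheory.Limits
open Literature.AlgebraicTopology.SingularHomology
open Literature.AlgebraicGeometry.Motives
open Literature.AlgebraicGeometry.VanGeemen1994 (hodgeClassSpan pullbackOne)
open Literature.AlgebraicGeometry.Milne1999
open Literature.Geometry.Kaehler (lefschetzPow)
open Literature.Barriers.HodgeConjecture (divisorClassesSpan)
open Literature.LinearAlgebra
open Polynomial

namespace Literature.AlgebraicGeometry.HodgeTheory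

section SubringClosure

variable {A : AbelianVariety ℂ} {h : complexBetti A.X 2} {ψ α β φ : A ⟶ A} {qa qb : ℂ[X]} {a b : ℂ}
  {P Q : Polynomial ℤ} {e m : ℕ}

/-- `(f ≫ g)^* = f^* ∘ g^*`. [folklore] -/
private theorem pbk_comp (f g : A ⟶ A) : pullbackOne A (f ≫ g) = pullbackOne A f * pullbackOne A g := by
  change (complexBetti.map (f.hom.hom.hom ≫ g.hom.hom.hom) 1).hom = _
  rw [complexBetti.map_comp, ModuleCat.hom_comp]
  rfl

/-- `0^* = 0`. [folklore] -/
private theorem pbk_zero : pullbackOne A (0 : A ⟶ A) = 0 := by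
  change (complexBetti.map (0 : A ⟶ A).hom.hom.hom 1).hom = 0
  rw [complexBetti_map_zero_one, ModuleCat.hom_zero]

/-- `(f + g)^* = f^* + g^*`. [folklore] -/
private theorem pbk_add (f g : A ⟶ A) : pullbackOne A (f + g) = pullbackOne A f + pullbackOne A g := by
  change (complexBetti.map (f + g).hom.hom.hom 1).hom = _
  rw [complexBetti_map_add_one, ModuleCat.hom_add]

/-- `(-f)^* = -f^*`. [folklore] -/
private theorem pbk_neg (f : A ⟶ A) : pullbackOne A (-f) = -pullbackOne A f := by
  change (complexBetti.map (-f).hom.hom.hom 1).hom = _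
  rw [complexBetti_map_neg_one, ModuleCat.hom_neg]

/-- `𝟙^* = 1`. [folklore] -/
private theorem pbk_id : pullbackOne A (𝟙 A) = 1 := by
  refine LinearMap.ext fun v ↦ ?_
  change singularCohomology.map ℂ ℂ (Motives.AlgPoints.mapContinuous (L := ℂ) (𝟙 A : A ⟶ A).hom.hom.hom) 1 v = v
  exact abelianVariety_map_id_apply v

/-- **Pull-back on `H¹` is a ring antihomomorphism `End(A) → End_ℂ(H¹(A(ℂ); ℂ))ᵒᵖ`**, so for `g` in the subring
`ℤ⟨Γ⟩ ⊆ End(A)` generated by `Γ`, `g^*` lies in the complex algebra generated by the `γ^*`, `γ ∈ Γ` (induction on the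
subring: `0`, `𝟙`, `+`, `-` preserved, `(g ≫ g′)^* = g^* ∘ g′^*`). [cite: LangeBirkenhake1992, §1.1 (the rational representation)] [cite: MoonenZarhin1998WeilClasses, §1 («F ⊆ End⁰(X)»; chunk p0002 L44–L60)] -/
theorem pullbackOne_mem_adjoin_of_mem_closure (Γ : Set (CategoryTheory.End A)) {g : CategoryTheory.End A}
    (hg : g ∈ Subring.closure Γ) :
    pullbackOne A (End.asHom g) ∈ Algebra.adjoin ℂ ((fun γ : CategoryTheory.End A ↦ pullbackOne A (End.asHom γ)) '' Γ) := by
  induction hg using Subring.closure_induction with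
  | mem x hx => exact Algebra.subset_adjoin ⟨x, hx, rfl⟩
  | zero =>
    have e : pullbackOne A (End.asHom (0 : CategoryTheory.End A)) = 0 := pbk_zero
    rw [e]
    exact Subalgebra.zero_mem _
  | one =>
    have e : pullbackOne A (End.asHom (1 : CategoryTheory.End A)) = 1 := pbk_id
    rw [e]
    exact Subalgebra.one_mem _
  | add x y _ _ hx hy =>
    have e : pullbackOne A (End.asHom (x + y)) = pullbackOne A (End.asHom x) + pullbackOne A (End.asHom y) :=
      pbk_add (End.asHom x) (End.asHom y)
    rw [e]
    exact Subalgebra.add_mem _ hx hy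
  | neg x _ hx =>
    have e : pullbackOne A (End.asHom (-x)) = -pullbackOne A (End.asHom x) := pbk_neg (End.asHom x)
    rw [e]
    exact Subalgebra.neg_mem _ hx
  | mul x y _ _ hx hy =>
    have e : pullbackOne A (End.asHom (x * y)) = pullbackOne A (End.asHom y) * pullbackOne A (End.asHom x) :=
      pbk_comp (End.asHom y) (End.asHom x)
    rw [e]
    exact Subalgebra.mul_mem _ hy hx

/-- `φ ∈ ℤ⟨α, β⟩ ⟹ φ^* ∈ ℂ⟨α^*, β^*⟩` — the hypothesis `hF` of `weilClassesField_le_divisorClassesSpan_of_quaternionPair`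
(`F = ℚ(φ) ⊆ ℚ⟨α, β⟩`). [cite: MoonenZarhin1998WeilClasses, §1 Table 1, Type 2 with m = 1 («B = D»; chunk p0002 L60–L84)] -/
theorem pullbackOne_mem_adjoin_pair_of_mem_closure
    (hφ : End.of φ ∈ Subring.closure {End.of α, End.of β}) :
    pullbackOne A φ ∈ Algebra.adjoin ℂ ({pullbackOne A α, pullbackOne A β} : Set (Module.End ℂ (complexBetti A.X 1))) := by
  refine Algebra.adjoin_mono ?_ (pullbackOne_mem_adjoin_of_mem_closure _ hφ)
  rintro _ ⟨γ, hγ, rfl⟩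
  rcases hγ with rfl | hγ
  · exact Set.mem_insert _ _
  · rw [Set.mem_singleton_iff.1 hγ]
    exact Set.mem_insert_of_mem _ (Set.mem_singleton _)

/-- `φ ∈ ℤ⟨ψ, α, β⟩ ⟹ φ^* ∈ ℂ⟨ψ^*, α^*, β^*⟩` — the hypothesis `hF` of
`weilClassesField_le_divisorClassesSpan_of_mem_adjoin_quaternionOver` (`F = ℚ(φ) ⊆ D = ℚ(ψ)⟨α, β⟩`). [cite: MoonenZarhin1998WeilClasses, §1 Table 1, Type 2 with m = 1 («B = D»; chunk p0002 L60–L84)] -/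
theorem pullbackOne_mem_adjoin_triple_of_mem_closure
    (hφ : End.of φ ∈ Subring.closure {End.of ψ, End.of α, End.of β}) :
    pullbackOne A φ ∈ Algebra.adjoin ℂ
      ({pullbackOne A ψ, pullbackOne A α, pullbackOne A β} : Set (Module.End ℂ (complexBetti A.X 1))) := by
  refine Algebra.adjoin_mono ?_ (pullbackOne_mem_adjoin_of_mem_closure _ hφ)
  rintro _ ⟨γ, hγ, rfl⟩
  rcases hγ with rfl | rfl | hγ
  · exact Set.mem_insert _ _
  · exact Set.mem_insert_of_mem _ (Set.mem_insert _ _)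
  · rw [Set.mem_singleton_iff.1 hγ]
    exact Set.mem_insert_of_mem _ (Set.mem_insert_of_mem _ (Set.mem_singleton _))

/-- **TYPE 2, `m = 1`, CENTRE `ℚ`, FROM End-LEVEL DATA: the Weil classes of `F = ℚ(φ)`, `φ ∈ ℤ⟨α, β⟩ ⊆ End(A)`, are
ALGEBRAIC** (hypotheses of `weilClassesField_le_algebraicClasses_of_quaternionPair` with `hF` replaced by
`φ ∈ Subring.closure {α, β}`). [cite: MoonenZarhin1998WeilClasses, Introduction (chunk p0001 L10–L18) and §1 Criterion (2), type 2 (chunk p0003 L46–L90)]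
[cite: VoisinHodgeI2002, Thm. 11.30] -/
theorem weilClassesField_le_algebraicClasses_of_mem_closure_quaternionPair
    (hPm : P.Monic) (hPe : P.natDegree = e) (hPirr : Irreducible (P.map (Int.castRingHom ℚ)))
    (hφ : Polynomial.eval₂ (Int.castRingHom (CategoryTheory.End A)) (φ : CategoryTheory.End A) P = 0)
    (her : e * (2 * m) = 2 * A.dim) (hh : h ∈ hodgeClassSpan A.dim A.X 1)
    (hnd : ∀ v : complexBetti A.X 1, (∀ w, polarizationPairingOne A.X h (A.dim - 1) v w = 0) → v = 0)
    (ha : a ≠ 0) (hα2 : pullbackOne A α * pullbackOne A α = a • 1)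
    (hb : b ≠ 0) (hβ2 : pullbackOne A β * pullbackOne A β = b • 1)
    (hanti : pullbackOne A α * pullbackOne A β = -(pullbackOne A β * pullbackOne A α))
    (hαsym : ∀ v w : complexBetti A.X 1, polarizationPairingOne A.X h (A.dim - 1) (pullbackOne A α v) w =
      polarizationPairingOne A.X h (A.dim - 1) v (pullbackOne A α w))
    (hβsym : ∀ v w : complexBetti A.X 1, polarizationPairingOne A.X h (A.dim - 1) (pullbackOne A β v) w =
      polarizationPairingOne A.X h (A.dim - 1) v (pullbackOne A β w))
    (hφe : End.of φ ∈ Subring.closure {End.of α, End.of β}) :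
    weilClassesField A φ P (2 * m) ≤ algebraicClasses A.X m :=
  weilClassesField_le_algebraicClasses_of_quaternionPair hPm hPe hPirr hφ her hh hnd ha hα2 hb hβ2 hanti hαsym hβsym
    (pullbackOne_mem_adjoin_pair_of_mem_closure hφe)

/-- **TYPE 2, `m = 1`, REAL-MULTIPLICATION CENTRE, FROM End-LEVEL DATA: the Weil classes of `F = ℚ(φ)`,
`φ ∈ ℤ⟨ψ, α, β⟩ ⊆ End(A)`, are ALGEBRAIC** (hypotheses of `weilClassesField_le_algebraicClasses_of_mem_adjoin_quaternionOver`
with `hF` replaced by `φ ∈ Subring.closure {ψ, α, β}`). [cite: MoonenZarhin1998WeilClasses, Introduction (chunk p0001 L10–L18) and §1 Criterion (2), type 2 (chunk p0003 L46–L90)]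
[cite: VoisinHodgeI2002, Thm. 11.30] -/
theorem weilClassesField_le_algebraicClasses_of_mem_closure_quaternionOver
    (hPm : P.Monic) (hPe : P.natDegree = e) (hPirr : Irreducible (P.map (Int.castRingHom ℚ)))
    (hφ : Polynomial.eval₂ (Int.castRingHom (CategoryTheory.End A)) (φ : CategoryTheory.End A) P = 0)
    (her : e * (2 * m) = 2 * A.dim) (hh : h ∈ hodgeClassSpan A.dim A.X 1)
    (hnd : ∀ v : complexBetti A.X 1, (∀ w, polarizationPairingOne A.X h (A.dim - 1) v w = 0) → v = 0)
    (hψsym : ∀ v w : complexBetti A.X 1, polarizationPairingOne A.X h (A.dim - 1) (pullbackOne A ψ v) w =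
      polarizationPairingOne A.X h (A.dim - 1) v (pullbackOne A ψ w))
    (hQm : Q.Monic) (hQirr : Irreducible (Q.map (Int.castRingHom ℚ)))
    (hψQ : Polynomial.eval₂ (Int.castRingHom (CategoryTheory.End A)) (ψ : CategoryTheory.End A) Q = 0)
    (hα2 : pullbackOne A α * pullbackOne A α = aeval (pullbackOne A ψ) qa)
    (hqa : ∀ z : ℂ, (Q.map (Int.castRingHom ℂ)).IsRoot z → qa.eval z ≠ 0)
    (hβ2 : pullbackOne A β * pullbackOne A β = aeval (pullbackOne A ψ) qb)
    (hqb : ∀ z : ℂ, (Q.map (Int.castRingHom ℂ)).IsRoot z → qb.eval z ≠ 0)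
    (hanti : pullbackOne A α * pullbackOne A β = -(pullbackOne A β * pullbackOne A α))
    (hαsym : ∀ v w : complexBetti A.X 1, polarizationPairingOne A.X h (A.dim - 1) (pullbackOne A α v) w =
      polarizationPairingOne A.X h (A.dim - 1) v (pullbackOne A α w))
    (hβsym : ∀ v w : complexBetti A.X 1, polarizationPairingOne A.X h (A.dim - 1) (pullbackOne A β v) w =
      polarizationPairingOne A.X h (A.dim - 1) v (pullbackOne A β w))
    (hψα : pullbackOne A ψ * pullbackOne A α = pullbackOne A α * pullbackOne A ψ)
    (hψβ : pullbackOne A ψ * pullbackOne A β = pullbackOne A β * pullbackOne A ψ)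
    (hφe : End.of φ ∈ Subring.closure {End.of ψ, End.of α, End.of β}) :
    weilClassesField A φ P (2 * m) ≤ algebraicClasses A.X m :=
  weilClassesField_le_algebraicClasses_of_mem_adjoin_quaternionOver hPm hPe hPirr hφ her hh hnd hψsym hQm hQirr hψQ hα2
    hqa hβ2 hqb hanti hαsym hβsym hψα hψβ (pullbackOne_mem_adjoin_triple_of_mem_closure hφe)

end SubringClosure

end Literature.AlgebraicGeometry.HodgeTheory

end
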